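import Literature.Computability.Cryptography.ComPRGExtraction
import Literature.Computability.Cryptography.ComPRGHidingMachine
import Literature.Computability.Cryptography.MildlyNonuniformPRG
import Literature.Computability.Cryptography.PseudorandomnessPRFProofs
import HarnessLib

/-!
# A pseudorandom generator from a bit-commitment scheme, VII: assembly (`BitCommitmentExist → PRGExist`)

Topic `Literature/Computability/Cryptography`. The last file of the series `ComPRGSpec` / `ComPRGProgram` /
`ComPRGModel` / `ComPRGExtraction` / `ComPRGHiding` / `ComPRGHidingMachine`, which formalise the proof of
M. Luby, *Pseudorandomness and Cryptographic Applications* (Princeton UP 1996), Lecture 10, Thm. 10.3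
("a false entropy generator implies a pseudorandom generator", the mildly non-uniform version) for the
false-entropy generator `F(b, r) = (commit(1ⁿ, b; r), b)` of a bit-commitment scheme (Lecture 13, p. 137: a
one-sidedly binding, computationally hiding commitment has one bit of false entropy).

* `pS_le_bindingError`: the fraction of ambiguous honest blocks is at most the binding error, so for a
  statistically binding scheme the side condition `5·t·√pS ≤ 1` of Step 1 holds eventually
  (`eventually_small_pS`).
* `isPseudorandom_candI`: the three steps — Step 1 (`ComPRG.Setup.step1`, leftover hash on the committed pairs),
  Step 2 (`isCompIndistinguishable_hybrids`, the hiding hybrid) and Step 3 (`ComPRG.Setup.step3`, leftover hash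
  on the seed) — give the pseudorandomness of the candidate of the good (non-computable) index `kGood n` with
  one bit of stretch.
* `PRGExist_of_bitCommitmentExist`: the mildly non-uniform family of candidates is turned into a pseudorandom
  generator by `PRGExist_of_advice_levels` (stretch each candidate, XOR them, all seed lengths — Håstad–
  Impagliazzo–Levin–Luby 1999, Prop. 4.8.1 with Prop. 3.3.4), exactly as in the last paragraph of Luby's proof
  ("use Theorem 3.3 … and Exercise 13 to combine the `p(n)+1` candidates"); and `PRFExist_of_bitCommitmentExist`
  by Goldreich–Goldwasser–Micali (`PRFExist_of_PRGExist_holds`).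

All proved; no named facts.

## References

* M. Luby, *Pseudorandomness and Cryptographic Applications*, Princeton University Press 1996, Lecture 10,
  Thm. 10.3 and its proof; Lecture 13, p. 137 (bit commitment and false entropy).
* J. Håstad, R. Impagliazzo, L. Levin, M. Luby, *A pseudorandom generator from any one-way function*, SIAM J.
  Comput. 28 (1999), Prop. 4.8.1, Prop. 3.3.4.
* O. Goldreich, *Foundations of Cryptography I*, CUP 2001, Def. 4.4.1, Thm. 3.6.6.
-/

namespace Literature.Computability.Cryptography

open _root_.Computability Complexity Complexity.Brick Complexity.BitCodec Polynomial Hybrid AffineStr Finset RepSampI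
  PRGStretch Filter Asymptotics FalseEntropy Topology

namespace ComPRG

namespace Setup

variable {S : Setup}

/-! ### Binding makes the honest pair almost injective -/

/-- **The binding error as an average over the sender's coins**:
`bindingError n = Pr_{r ← U_ρ}[commit(1ⁿ, 0; r) can be opened as 1]`. [cite: Goldreich2001, Def. 4.4.1 (2)] -/
theorem bindingError_eq (n : ℕ) [DecidablePred (· ∈ S.C.ambiguousSet n)] :
    S.C.bindingError n = uniformAvg (S.ρ n) fun r => if S.comRun n false r ∈ S.C.ambiguousSet n then (1 : ℝ) else 0 := by
  unfold BitCommitment.bindingError uniformAvg comRun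
  rw [RandAlg.pr_eq_card_filter_div S.C.commit commitCode (n, false) (S.C.ambiguousSet n) (m := S.ρ n) (S.ρ_eq n false).symm,
    Finset.natCast_card_filter]

/-- **The ambiguous fraction is at most the binding error**: `pS n ≤ bindingError n` (an ambiguous honest block
has bit `0` and an ambiguous commitment string). [cite: Luby1996, Lecture 13, p. 137; Goldreich2001, Def. 4.4.1 (2)] -/
theorem pS_le_bindingError (hS : S.WF) (n : ℕ) : S.pS n ≤ S.C.bindingError n := by
  classical
  have hρJ : S.ρ n ≤ S.J n := S.ρ_le_J hS n
  -- `pS` as an average of an indicator over the blocks, bounded by the indicator of an ambiguous commitment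
  have h1 : S.pS n ≤ uniformAvg (S.L0 n) fun l =>
      if S.comRun n false ((l.drop 1).take (S.ρ n)) ∈ S.C.ambiguousSet n then (1 : ℝ) else 0 := by
    unfold pS uniformAvg
    rw [card_Blk, ambig, Finset.natCast_card_filter, Nat.cast_pow, Nat.cast_two]
    refine div_le_div_of_nonneg_right (Finset.sum_le_sum fun x _ => ?_) (by positivity)
    dsimp only
    by_cases hx : S.bitOf x = false ∧ ∃ w', S.bitOf w' = true ∧ S.Cm n w' = S.Cm n x
    · obtain ⟨hb, x', hb', hc⟩ := hx
      rw [if_pos ⟨hb, x', hb', hc⟩, if_pos]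
      refine ⟨S.coinsOf x', ?_, ?_⟩
      · show (S.coinsOf x').length = S.ρ n
        rw [coinsOf, List.length_take, List.length_drop, x'.toList_length]
        unfold L0; omega
      · have h : S.Cm n x' = S.Cm n x := hc
        rw [Cm, Cm, hb', hb] at h
        exact h
    · rw [if_neg hx]; positivity
  refine h1.trans (le_of_eq ?_)
  -- drop the bit and the unused coins
  have hL : S.L0 n = 1 + (S.ρ n + (S.L0 n - 1 - S.ρ n)) := by unfold L0; omega
  rw [bindingError_eq, hL, uniformAvg_append]
  have hinner : ∀ u : List Bool, u.length = 1 →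
      (uniformAvg (S.ρ n + (S.L0 n - 1 - S.ρ n)) fun w =>
        if S.comRun n false (((u ++ w).drop 1).take (S.ρ n)) ∈ S.C.ambiguousSet n then (1 : ℝ) else 0) =
      uniformAvg (S.ρ n) fun r => if S.comRun n false r ∈ S.C.ambiguousSet n then (1 : ℝ) else 0 := by
    intro u hu
    obtain ⟨b, rfl⟩ := List.length_eq_one_iff.1 hu
    rw [uniformAvg_append]
    refine uniformAvg_congr fun r hr => ?_
    rw [uniformAvg_congr fun w _ => by
      rw [show (([b] ++ (r ++ w)).drop 1).take (S.ρ n) = r by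
        show (r ++ w).take (S.ρ n) = r
        rw [List.take_append_of_le_length hr.ge, List.take_of_length_le hr.le]]]
    exact uniformAvg_const _ _
  rw [uniformAvg_congr hinner]
  exact uniformAvg_const _ _

/-- **The side condition of Step 1 holds eventually** for a statistically binding scheme:
`5·t(n)·√(pS n) ≤ 1` for all large `n`. [cite: Luby1996, Lecture 10, Theorem 10.3 (proof, Step 1); Goldreich2001, Def. 4.4.1 (2)] -/
theorem eventually_small_pS (hS : S.WF) (hb : S.C.IsStatisticallyBinding) :
    ∀ᶠ n in atTop, 5 * (S.t n : ℝ) * Real.sqrt (S.pS n) ≤ 1 := by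
  have h := (hb.polynomial_mul ((25 * S.tP ^ 2).map (Nat.castRingHom ℝ))) 0
  simp only [pow_zero, one_mul] at h
  have heval : ∀ n : ℕ, ((25 * S.tP ^ 2).map (Nat.castRingHom ℝ)).eval (n : ℝ) = 25 * (S.t n : ℝ) ^ 2 := fun n => by
    rw [eval_map, eval₂_at_natCast, eq_natCast, Nat.cast_id, eval_mul, eval_pow, tP_eval, eval_ofNat]
    push_cast; ring
  filter_upwards [h.eventually (eventually_lt_nhds one_pos)] with n hn
  rw [heval] at hn
  have hpS := S.pS_nonneg n
  have hle : 25 * (S.t n : ℝ) ^ 2 * S.pS n ≤ 1 :=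
    (mul_le_mul_of_nonneg_left (S.pS_le_bindingError hS n) (by positivity)).trans hn.le
  have hsq : (5 * (S.t n : ℝ) * Real.sqrt (S.pS n)) ^ 2 ≤ 1 := by
    rw [mul_pow, Real.sq_sqrt hpS]; nlinarith
  exact (pow_le_one_iff_of_nonneg (by positivity) two_ne_zero).1 hsq

/-! ### The three steps combined -/

/-- Geometric sequences are negligible. [folklore] -/
private theorem spd_geom {r : ℝ} (hr0 : 0 ≤ r) (hr1 : r < 1) (c : ℝ) :
    SuperpolynomialDecay atTop (fun n : ℕ => (n : ℝ)) fun n => c * r ^ n := by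
  intro m
  have h := (tendsto_pow_const_mul_const_pow_of_abs_lt_one m (r := r) (by rwa [abs_of_nonneg hr0])).const_mul c
  rw [mul_zero] at h
  refine h.congr fun n => ?_
  ring

/-- `2^{−sl n} = (1/2)^{n+1}`. [folklore] -/
private theorem two_rpow_neg_sl (n : ℕ) : (2 : ℝ) ^ (-((sl n : ℕ) : ℝ)) = (1 / 2) ^ (n + 1) := by
  rw [Real.rpow_neg (by norm_num), Real.rpow_natCast, sl, one_div, inv_pow]

/-- The explicit error terms of Steps 1 and 3 are dominated by two geometric sequences. [folklore] -/
private theorem errors_le (n : ℕ) :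
    2⁻¹ * (2 : ℝ) ^ (-((sl n : ℕ) : ℝ)) + Real.exp (-2 * ((n : ℝ) + 1)) +
        (2⁻¹ * (2 : ℝ) ^ (-((sl n : ℕ) : ℝ)) + Real.exp (-(((n : ℝ) + 1) / 2))) ≤
      2 * (1 / 2 : ℝ) ^ n + 2 * Real.exp (-1 / 2) ^ n := by
  have hh : 2⁻¹ * (2 : ℝ) ^ (-((sl n : ℕ) : ℝ)) ≤ (1 / 2 : ℝ) ^ n := by
    rw [two_rpow_neg_sl, pow_succ]
    have : (0 : ℝ) ≤ (1 / 2) ^ n := by positivity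
    nlinarith
  have he : ∀ x : ℝ, x ≤ (n : ℝ) * (-1 / 2) → Real.exp x ≤ Real.exp (-1 / 2) ^ n := fun x hx => by
    rw [← Real.exp_nat_mul]; exact Real.exp_le_exp.2 hx
  have h2 := he (-2 * ((n : ℝ) + 1)) (by nlinarith [(Nat.cast_nonneg n : (0 : ℝ) ≤ n)])
  have h3 := he (-(((n : ℝ) + 1) / 2)) (by nlinarith [(Nat.cast_nonneg n : (0 : ℝ) ≤ n)])
  linarith

/-- **Luby's Theorem 10.3 for the commitment's false-entropy generator**: for a computationally hiding,
statistically binding scheme the candidate generator of the good index `kGood n` — seed `U_{a(n)}`, output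
`a(n) + 1` bits — is pseudorandom. Step 1 (`step1`): leftover hash of the committed pairs, Step 2
(`isCompIndistinguishable_hybrids`): the hiding hybrid, Step 3 (`step3`): leftover hash of the seed.
[cite: Luby1996, Lecture 10, Theorem 10.3 (proof, Steps 1–3); Lecture 13, p. 137] -/
theorem isPseudorandom_candI (hS : S.WF) (hhid : S.C.IsComputationallyHiding) (hb : S.C.IsStatisticallyBinding) :
    IsPseudorandom (seedEnsembleI S.candI S.aP S.kGood) fun n => S.aP.eval n + 1 := by
  intro D hD
  have hhyb := isCompIndistinguishable_hybrids hS hhid D hD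
  have hg1 : SuperpolynomialDecay atTop (fun n : ℕ => (n : ℝ)) fun n => (2 : ℝ) * (1 / 2) ^ n :=
    spd_geom (by norm_num) (by norm_num) 2
  have hg2 : SuperpolynomialDecay atTop (fun n : ℕ => (n : ℝ)) fun n => (2 : ℝ) * Real.exp (-1 / 2) ^ n :=
    spd_geom (Real.exp_pos _).le (Real.exp_lt_one_iff.2 (by norm_num)) 2
  refine ((hhyb.add hg1).add hg2).trans_eventually_abs_le ?_
  filter_upwards [eventually_small_pS hS hb, eventually_ge_atTop 1] with n hbind hn
  have h1 := S.step1 hS D n hbind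
  have h3 := S.step3 hS D hn
  have he := errors_le n
  have hadv : distAdvantage D (S.X fun _ => 0) (S.X S.t) n =
      |(acceptPMF D n (S.X (fun _ => 0) n) true).toReal - (acceptPMF D n (S.X S.t n) true).toReal| := rfl
  simp only [Function.comp_apply, Pi.add_apply]
  rw [abs_of_nonneg (distAdvantage_nonneg _ _ _ _),
    abs_of_nonneg (add_nonneg (add_nonneg (distAdvantage_nonneg _ _ _ _) (by positivity)) (by positivity)), hadv]
  unfold distAdvantage uniformEnsemble
  simp only [aP_eval]
  have tri1 := abs_sub_le (acceptPMF D n (seedEnsembleI S.candI S.aP S.kGood n) true).toReal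
      (acceptPMF D n (S.X (fun _ => 0) n) true).toReal (acceptPMF D n (uniformBits (S.a n + 1)) true).toReal
  have tri2 := abs_sub_le (acceptPMF D n (S.X (fun _ => 0) n) true).toReal
      (acceptPMF D n (S.X S.t n) true).toReal (acceptPMF D n (uniformBits (S.a n + 1)) true).toReal
  linarith

/-! ### Pseudorandom generators and functions from bit commitment -/

/-- **PRG from a well-formed commitment setup**: stretch every candidate, XOR the `mCnt(n)` stretched candidates
on independent seeds, all seed lengths (`PRGExist_of_advice_levels`). [cite: Luby1996, Lecture 10, Theorem 10.3
(proof, last paragraph: "combine the `p(n)+1` candidates"); HastadImpagliazzoLevinLuby1999, Prop. 4.8.1] -/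
theorem PRGExist_of_WF (hS : S.WF) (hhid : S.C.IsComputationallyHiding) (hb : S.C.IsStatisticallyBinding) : PRGExist :=
  PRGExist_of_advice_levels (G := S.candI) S.aP S.mP (aStar := S.kGood) (S.candI_mem_FP hS)
    (fun N => by rw [mP_eval]; exact (S.kGood_lt_mCnt hS N).le)
    (fun N s hs => by rw [candI_boolPair, S.length_cand N _ (by rw [hs, aP_eval]), aP_eval])
    (isPseudorandom_candI hS hhid hb)

end Setup

end ComPRG

/-- **Bit commitment implies pseudorandom generators** (Luby 1996, Thm. 10.3 applied to the false-entropy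
generator `(commit(b; r), b)` of the scheme, Lecture 13, p. 137; the mildly non-uniform guesses of the coin
count and of the entropy are removed by the XOR combiner).
[cite: Luby1996, Lecture 10, Theorem 10.3; Lecture 13, p. 137; HastadImpagliazzoLevinLuby1999, Prop. 4.8.1] -/
theorem PRGExist_of_bitCommitmentExist : BitCommitmentExist → PRGExist := by
  rintro ⟨C, heff, hhid, hb⟩
  obtain ⟨S, rfl, hS⟩ := ComPRG.Setup.exists_wf heff
  exact ComPRG.Setup.PRGExist_of_WF hS hhid hb

/-- **Bit commitment implies pseudorandom functions** (with Goldreich–Goldwasser–Micali).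
[cite: Luby1996, Lecture 10, Theorem 10.3; Goldreich2001, Thm. 3.6.6] -/
theorem PRFExist_of_bitCommitmentExist : BitCommitmentExist → PRFExist := fun h =>
  PRFExist_of_PRGExist_holds (PRGExist_of_bitCommitmentExist h)

end Literature.Computability.Cryptography
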